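/-
Copyright (c) 2026 the pub-hodgecm-mathlib formalisation cell (harness21).  Prover seat hodgecm-mathlib-LH4-p03 (g5), 2026-09-02: «LEVEL NORMS AT A RAMIFIED CM PLACE»
(name F0P3a-p06 (g18); LH4-plan (g5) WORD #3; ref5 (g9) R-563) — the wild twin of the `hnorm` clause of ★ `ramifiedBlock_adicCompletion`.
-/
import Literature.NumberTheory.Automorphic.RamifiedPlaceDifferent        -- ★ F0P3a-p06 (g18): `valued_galAdicCompletionMap_sub_self_of_uniformizer`, `valued_two_mul_of_uniformizer`, `sq_ne_sq_mul_exp_neg_one`, Eisenstein basis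
import Literature.NumberTheory.LocalFields.WildQuadraticNormsNearOne     -- ★ B-p14 (g42): Hensel kernel `exists_valued_lt_one_mul_self_add_mul_eq`; brings ★ `CompleteValuedSquareRootNearOne` + adic completeness of `𝒪[K_v]`
import HarnessLib

/-!
# Level norms at a ramified CM place: `N(U_w^{(ψ(n))}) = U_v^{(n)}` for `n ≥ d`, `ψ(n) = 2n − d + 1`
# (Serre, *Local Fields* V §3 Prop. 5 (iii) ∕ Cor. 3 — the totally ramified quadratic case, ANY residue characteristic)

Topic `NumberTheory/Automorphic`; namespace `Literature.NumberTheory.Automorphic.UnitaryGroup`.  THEOREMS ONLY (no definition, no instance, no notation, no named fact,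
no `sorry`; axioms ⊆ {propext, Classical.choice, Quot.sound}).  Cell `pub/hodgecm-mathlib` (D-0151), crux H413 = `stmt-HodgeConjecture-24833`; half A line LH4, DYADIC
pay-down leaf `Cruxes/H413/Lines/F0_P3c_DyadicPaydown.lean`, organ (D-RAM) (PRINT by ruling D74′; census F0P3a-p06 (g17) `DUNR-H2-CENSUS.md` §4: the wild base layer
`L_w ∕ L⁺_v`).  HONEST LABEL: HC_CM is proved only modulo the 7 printed citations (2 remaining named inputs: hLiu418 = stmt-HodgeConjecture-24832, h413 =
stmt-HodgeConjecture-24833) until rung 0 closes.  HONEST READER LABEL (LH4-plan (g5) WORD #5): this file is the wild twin of ★ `ramifiedBlock_adicCompletion`'s `hnorm`;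
consumers: none live — (D-RAM) is a PRINT organ by D74′ (SCOPE-AUDIT b4c76626: COVERED at `v ∣ 2`); banked base layer; unconditional local algebra; count-neutral.

SETTING (= ★ `RamifiedPlaceDifferent`).  `L` CM, `v` a finite place of `L⁺`, `w ∣ v` with `c • w = w` and `e(w|v) ≠ 1`; `ι = toPlace v w : L⁺_v → L_w`,
`σ = σ_w = galAdicCompletionMap c hw`, `τ ∈ L_w` a uniformiser, `D := |στ − τ|_w = exp(−d)` the different number (★ `exists_different_of_ramified`; `τ`-independent).
Both valuations are normalised (`|ϖ_v|_v = exp(−1) = |τ|_w`, `|ι y|_w = |y|_v²`), so for `u ∈ L⁺_v` the hypothesis `|u − 1|_v ≤ D` reads «`u ∈ U_v^{(n)}` with `n ≥ d`»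
and the conclusion `|z − 1|_w · D ≤ |ι u − 1|_w · exp(−1)` reads «`z ∈ U_w^{(2n − d + 1)}`» — Serre's `ψ(n) = t + 2(n − t)` with `t = d − 1` the break.  That `d` is
ALSO the norm conductor `f` of `L_w ∕ L⁺_v` («`U_v^{(k)} ⊆ N ⟺ d ≤ k`») is ★ `exists_different_eq_conductor_of_ramified` (FILE 2 `RamifiedPlaceDifferentConductor`), and the
parity of `d` is the skew-uniformiser criterion ★ `exists_skew_uniformizer_iff` ∕ `exists_skew_unit_iff` (FILE 1) — neither is restated here.

THE THEOREM (HEAD, letters of F0P3a-p06 (g18)).  **`exists_mul_galAdicCompletionMap_eq_of_valued_sub_one_le`**: for a uniformiser `τ` and `u ∈ L⁺_v` with `|u − 1|_v ≤ |στ − τ|_w`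
there is `z ∈ L_w` with `z · σ z = ι u` and `|z − 1|_w · |στ − τ|_w ≤ |ι u − 1|_w · exp(−1)` — every principal unit of depth `n ≥ d` is a norm from the principal units of
depth `ψ(n) = 2n − d + 1`.  At a TAME place (`d = 1`) this is exactly the `hnorm` conjunct `|z − 1| ≤ |u − 1|` of ★ `ramifiedBlock_adicCompletion`; here no hypothesis on
the residue characteristic is made.
PROOF (two cases, as in ★ `RamifiedPlaceDifferentConductor`; no new Hensel).  Eisenstein data `τ + στ = ι u₀`, `τ·στ = −ι v₀` (★ `exists_eisenstein_coeffs_of_ramified`),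
`D = max |ι u₀| |2τ|` (★ `valued_galAdicCompletionMap_sub_self_of_uniformizer`), the two values of opposite parity.
* §1 ODD `|ι u₀| < |2τ|` (`D = |2τ| = |4|_v · exp(−1)`): `|u − 1| < |4|_v`, so `u = r·r` with `|r − 1| < |2|` (★ `exists_mul_self_eq_of_valued_sub_one_lt_four_adicCompletion`),
  whence `|r + 1| = |2|` and `|r − 1|·|2| = |u − 1|`; WITNESS `z := ι r` (`σ` fixes `ι`): `|z − 1|_w · D = |r − 1|²·|2|²·exp(−1) = |ι u − 1|_w · exp(−1)` — equality.
* §2 EVEN `|2τ| < |ι u₀|` (`D = |ι u₀| = |u₀|²`): with `ε := (u − 1)·v₀ ∕ u₀²` (`|ε| ≤ exp(−1)`), the Hensel kernel (★ `exists_valued_lt_one_mul_self_add_mul_eq`, `b = 1`) gives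
  `x·x + x = −ε`, `|x| < 1`; `W := 1 + x` is a unit with `W·W = W − ε`; WITNESS `z := 1 + ι q · τ`, `q := (u − 1) ∕ (u₀ W)`: by the norm form in the Eisenstein basis
  (★ `toPlace_add_mul_mul_galAdicCompletionMap_eq`) `z·σz = ι(1 + q u₀ − q² v₀) = ι u`, and `|z − 1|_w · D = |q|²·exp(−1)·|u₀|² = |u − 1|²·exp(−1)` — equality.
* §3 HEAD (d-free, as lettered); the σ-FIXED dress `exists_mul_galAdicCompletionMap_eq_of_valued_sub_one_le'` in the binder order of ★ `ramifiedBlock_adicCompletion`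
  (`(u : L_w) (hσu : σ u = u) (hu)`; a σ-fixed `u` descends by ★ `exists_toPlace_eq_of_galAdicCompletionMap_eq`, and «depth `n ≥ d`» reads `|u − 1|_w ≤ D²` in `w`-letters);
  and the DEPTH READINGS with the binder `hd : |στ − τ| = exp(−d)` (Serre's letters): (LN1) `exists_mul_galAdicCompletionMap_eq_of_valued_sub_one_le_exp_neg` (`d ≤ n`,
  `|u − 1|_v ≤ exp(−n)` ⇒ `|z − 1|_w ≤ exp(−(2n − d + 1))`, i.e. `U_v^{(n)} ⊆ N(U_w^{(ψ(n))})`), (LN3) `exists_mul_galAdicCompletionMap_eq_of_fixed_of_valued_sub_one_le_exp_neg`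
  (σ-fixed `u ∈ L_w`, `|u − 1|_w ≤ exp(−2n)`).
* §4 THE CONVERSE INCLUSION, as the hypothesis-free bound `valued_mul_galAdicCompletionMap_sub_one_le`: `|z·σz − 1|_w ≤ max (|z − 1|_w · D · exp 1) (|z − 1|_w²)`
  (`N(1 + y) − 1 = Tr y + N y`, `Tr(ι p + ι q τ) = ι(2p + q u₀)`, `|N y| = |y|²`), and its depth reading (LN2) `valued_mul_galAdicCompletionMap_sub_one_le_exp_neg`
  (`d ≤ n`, `|z − 1|_w ≤ exp(−(2n − d + 1))` ⇒ `|z·σz − 1|_w ≤ exp(−2n)`, i.e. `N(U_w^{(ψ(n))}) ⊆ U_v^{(n)}`): together, `N(U_w^{(2n − d + 1)}) = U_v^{(n)}` EXACTLY for `n ≥ d`.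
NOT HERE (honest scope): the graded structure at the break (`n = t = d − 1`: the norm residue map `ξ ↦ ξ² + ᾱξ` and its index-2 image, Serre V §3 Prop. 5 (ii)), and any
statement about `U_v^{(n)}` for `n < d` (there the answer is the conductor theorem ★ `forall_exists_mul_galAdicCompletionMap_eq_iff_exp_neg_le`: NOT all of `U_v^{(n)}` is a norm).

## References
* [Serre1979] J.-P. Serre, *Local Fields*, GTM 67 (1979): Ch. V §3 Prop. 5 (iii) & Cor. 3 (`N(U_L^{ψ(n)}) = U_K^n`, `N(U_L^{ψ(n)+1}) = U_K^{n+1}` for `n > t`, cyclic totally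
  ramified of prime degree), Ch. V §1 (`U^{(n)}`), Ch. IV §1 Prop. 4 & §2 (`t + 1 = d = i_G(σ)` in the quadratic case), Ch. III §3 Prop. 7 (`Tr 𝔭_L^m = 𝔭_K^{⌊(m+d)∕e⌋}`),
  Ch. II §4 Prop. 7 (Hensel).
* [NeukirchANT1999] J. Neukirch, *Algebraic Number Theory* (1999): Ch. V (1.2)–(1.3) (norm groups of the unit filtration), Ch. II (4.6).
-/

set_option autoImplicit false

noncomputable section

open NumberField IsDedekindDomain ValuativeRel
open scoped ValuativeRel WithZero

namespace Literature.NumberTheory.Automorphic.UnitaryGroup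

variable (L : Type) [Field L] [NumberField L] [IsCMField L] (v : HeightOneSpectrum (𝓞 ↥(maximalRealSubfield L)))
  (w : PlacesOver L v) (hw : IsCMField.complexConj L • w.1 = w.1) (he : v.asIdeal.ramificationIdx' w.1.asIdeal ≠ 1)

/-! ## §0 Scalars: `2 ≠ 0` in `L⁺_v`, three facts in `ℤᵐ⁰` -/

omit [IsCMField L] in
/-- `2 ≠ 0` in `L⁺_v` (characteristic zero). [folklore] -/
private theorem two_ne_zero_base : (2 : v.adicCompletion ↥(maximalRealSubfield L)) ≠ 0 := by
  rw [show (2 : v.adicCompletion ↥(maximalRealSubfield L)) = algebraMap ↥(maximalRealSubfield L) _ 2 by rw [map_ofNat]]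
  exact (_root_.map_ne_zero (algebraMap ↥(maximalRealSubfield L) (v.adicCompletion ↥(maximalRealSubfield L)))).2 two_ne_zero

/-- In `ℤᵐ⁰`: `exp(−1) < 1`. [cite: Serre1979, Ch. II §1] -/
theorem exp_neg_one_lt_one_withZero : WithZero.exp (-1 : ℤ) < 1 := by
  rw [← WithZero.exp_zero, WithZero.exp_lt_exp]; norm_num

/-- In `ℤᵐ⁰`: `x · exp(−1) < x` for `x ≠ 0` (one step down). [cite: Serre1979, Ch. II §1] -/
theorem mul_exp_neg_one_lt_self {x : WithZero (Multiplicative ℤ)} (hx : x ≠ 0) : x * WithZero.exp (-1 : ℤ) < x := by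
  obtain ⟨m, hm⟩ : ∃ m : ℤ, x = WithZero.exp m := ⟨_, (WithZero.exp_log hx).symm⟩
  rw [hm, ← WithZero.exp_add, WithZero.exp_lt_exp]; omega

/-- In `ℤᵐ⁰`: `a² ≤ b² → a ≤ b` (squaring is strictly monotone). [cite: Serre1979, Ch. II §1] -/
theorem le_of_sq_le_sq_withZero {a b : WithZero (Multiplicative ℤ)} (h : a ^ 2 ≤ b ^ 2) : a ≤ b := by
  by_contra hba
  exact absurd h (not_le.2 (pow_lt_pow_left₀ (not_le.1 hba) zero_le two_ne_zero))

/-! ## §1 The ODD case `|ι u₀| < |2τ|` (`d = 2·ord_v 2 + 1`): the witness is `ι √u` -/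

include hw he in
/-- **LEVEL NORMS, ODD CASE.**  If the trace `ι u₀ = τ + στ` of the uniformiser `τ` satisfies `|ι u₀| < |2τ|` (so `|στ − τ| = |2τ| = |4|_v · exp(−1)`, `d` odd), then every
`u ∈ L⁺_v` with `|u − 1|_v ≤ |στ − τ|_w` is a norm `z·σz = ι u` with `|z − 1|_w · |στ − τ|_w ≤ |ι u − 1|_w · exp(−1)`: indeed `|u − 1| < |4|_v`, so `u = r·r` with `|r − 1| < |2|`
(★ square root near `1`), `|r + 1| = |2|`, and `z := ι r` is `σ`-fixed with `|ι r − 1|_w · |2τ| = |r − 1|²·|2|²·exp(−1) = |u − 1|²·exp(−1)` — equality.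
[cite: Serre1979, Ch. V §3 Prop. 5 (iii), Cor. 3] [cite: Serre1979, Ch. XIV §4] -/
theorem exists_mul_galAdicCompletionMap_eq_of_valued_sub_one_le_of_lt {τ : w.1.adicCompletion L} (hτ : Valued.v τ = WithZero.exp (-1 : ℤ))
    {u₀ : v.adicCompletion ↥(maximalRealSubfield L)} (htr : τ + galAdicCompletionMap (L := L) (IsCMField.complexConj L) hw τ = toPlace v w u₀)
    (hlt : Valued.v (toPlace v w u₀) < Valued.v (2 * τ))
    {u : v.adicCompletion ↥(maximalRealSubfield L)} (hu : Valued.v (u - 1) ≤ Valued.v (galAdicCompletionMap (L := L) (IsCMField.complexConj L) hw τ - τ)) :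
    ∃ z : w.1.adicCompletion L, z * galAdicCompletionMap (L := L) (IsCMField.complexConj L) hw z = toPlace v w u ∧
      Valued.v (z - 1) * Valued.v (galAdicCompletionMap (L := L) (IsCMField.complexConj L) hw τ - τ) ≤
        Valued.v (toPlace v w u - 1) * WithZero.exp (-1 : ℤ) := by
  have h2ne : Valued.v (2 : v.adicCompletion ↥(maximalRealSubfield L)) ≠ 0 := (Valuation.ne_zero_iff _).2 (two_ne_zero_base L v)
  -- `D = |2τ| = |2|_v² · exp(−1)`
  have hD : Valued.v (galAdicCompletionMap (L := L) (IsCMField.complexConj L) hw τ - τ) =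
      Valued.v (2 : v.adicCompletion ↥(maximalRealSubfield L)) ^ 2 * WithZero.exp (-1 : ℤ) := by
    rw [valued_galAdicCompletionMap_sub_self_of_uniformizer L v w hw he hτ htr, max_eq_right hlt.le, valued_two_mul_of_uniformizer L v w hw he hτ]
  -- `|u − 1| < |4|`
  have hu4 : Valued.v (u - 1) < Valued.v (4 : v.adicCompletion ↥(maximalRealSubfield L)) := by
    have h4 : Valued.v (4 : v.adicCompletion ↥(maximalRealSubfield L)) = Valued.v (2 : v.adicCompletion ↥(maximalRealSubfield L)) ^ 2 := by
      rw [← map_pow]; norm_num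
    rw [h4]
    exact lt_of_le_of_lt (hD ▸ hu) (mul_exp_neg_one_lt_self (pow_ne_zero 2 h2ne))
  obtain ⟨r, hru, hr1⟩ :=
    Literature.NumberTheory.LocalFields.exists_mul_self_eq_of_valued_sub_one_lt_four_adicCompletion (↥(maximalRealSubfield L)) v u hu4
  -- `|r + 1| = |2|` and `|r − 1|·|2| = |u − 1|`
  have hr2 : Valued.v (r + 1) = Valued.v (2 : v.adicCompletion ↥(maximalRealSubfield L)) := by
    rw [show r + 1 = 2 + (r - 1) by ring]
    exact Valuation.map_add_eq_of_lt_left _ hr1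
  have hlev : Valued.v (r - 1) * Valued.v (2 : v.adicCompletion ↥(maximalRealSubfield L)) = Valued.v (u - 1) := by
    rw [← hr2, ← map_mul]
    congr 1
    rw [← hru]; ring
  refine ⟨toPlace v w r, ?_, ?_⟩
  · rw [galAdicCompletionMap_toPlace (IsCMField.complexConj L) w w hw r, ← map_mul, hru]
  · refine le_of_eq ?_
    rw [← map_one (toPlace v w), ← map_sub, ← map_sub, valued_toPlace_eq_sq_of_ramified L v w hw he, valued_toPlace_eq_sq_of_ramified L v w hw he, hD,
      ← hlev, mul_pow, mul_assoc]

/-! ## §2 The EVEN case `|2τ| < |ι u₀|` (`d = 2·ord_v u₀`): the witness is `1 + ι q · τ` by the Hensel kernel -/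

include hw he in
/-- **LEVEL NORMS, EVEN CASE.**  If the Eisenstein data `τ + στ = ι u₀`, `τ·στ = −ι v₀` (`|v₀| = exp(−1)`) of the uniformiser `τ` satisfy `|2τ| < |ι u₀|` (so `|στ − τ| = |ι u₀| =
|u₀|²`, `d` even), then every `u ∈ L⁺_v` with `|u − 1|_v ≤ |στ − τ|_w` is a norm `z·σz = ι u` with `|z − 1|_w · |στ − τ|_w ≤ |ι u − 1|_w · exp(−1)`: with `ε := (u − 1) v₀ ∕ u₀²`
(`|ε| ≤ exp(−1)`) the Hensel kernel gives `x·x + x = −ε`, `|x| < 1`; `W := 1 + x` is a unit with `W·W = W − ε`, and `z := 1 + ι q·τ`, `q := (u − 1)∕(u₀ W)` has norm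
`ι(1 + q u₀ − q² v₀) = ι u` and level `|z − 1|_w · |u₀|² = |q|²·exp(−1)·|u₀|² = |u − 1|²·exp(−1)` — equality. [cite: Serre1979, Ch. V §3 Prop. 5 (iii), Cor. 3] [cite: Serre1979, Ch. II §4 Prop. 7] -/
theorem exists_mul_galAdicCompletionMap_eq_of_valued_sub_one_le_of_gt {τ : w.1.adicCompletion L} (hτ : Valued.v τ = WithZero.exp (-1 : ℤ))
    {u₀ v₀ : v.adicCompletion ↥(maximalRealSubfield L)} (htr : τ + galAdicCompletionMap (L := L) (IsCMField.complexConj L) hw τ = toPlace v w u₀)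
    (hnm : τ * galAdicCompletionMap (L := L) (IsCMField.complexConj L) hw τ = -toPlace v w v₀) (hv₀ : Valued.v v₀ = WithZero.exp (-1 : ℤ))
    (hgt : Valued.v (2 * τ) < Valued.v (toPlace v w u₀))
    {u : v.adicCompletion ↥(maximalRealSubfield L)} (hu : Valued.v (u - 1) ≤ Valued.v (galAdicCompletionMap (L := L) (IsCMField.complexConj L) hw τ - τ)) :
    ∃ z : w.1.adicCompletion L, z * galAdicCompletionMap (L := L) (IsCMField.complexConj L) hw z = toPlace v w u ∧
      Valued.v (z - 1) * Valued.v (galAdicCompletionMap (L := L) (IsCMField.complexConj L) hw τ - τ) ≤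
        Valued.v (toPlace v w u - 1) * WithZero.exp (-1 : ℤ) := by
  -- `D = |ι u₀| = |u₀|²`, `u₀ ≠ 0`, `v₀ ≠ 0`
  have hD : Valued.v (galAdicCompletionMap (L := L) (IsCMField.complexConj L) hw τ - τ) = Valued.v u₀ ^ 2 := by
    rw [valued_galAdicCompletionMap_sub_self_of_uniformizer L v w hw he hτ htr, max_eq_left hgt.le, valued_toPlace_eq_sq_of_ramified L v w hw he]
  have hu₀ : u₀ ≠ 0 := by
    rintro rfl
    rw [map_zero, map_zero] at hgt
    exact absurd hgt (not_lt.2 zero_le)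
  have hvu₀ : Valued.v u₀ ≠ 0 := (Valuation.ne_zero_iff _).2 hu₀
  have hv₀0 : v₀ ≠ 0 := (Valuation.ne_zero_iff Valued.v).1 (by rw [hv₀]; exact WithZero.coe_ne_zero)
  -- `ε := (u − 1) v₀ ∕ u₀²`, `|ε| ≤ exp(−1) < 1`
  obtain ⟨ε, hε⟩ : ∃ ε : v.adicCompletion ↥(maximalRealSubfield L), ε = (u - 1) * v₀ / u₀ ^ 2 := ⟨_, rfl⟩
  have hεu : ε * u₀ ^ 2 = (u - 1) * v₀ := by rw [hε]; exact div_mul_cancel₀ _ (pow_ne_zero 2 hu₀)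
  have hεv : Valued.v ε < 1 := by
    refine lt_of_le_of_lt ?_ exp_neg_one_lt_one_withZero
    rw [hε, map_div₀, map_pow, div_le_iff₀ (zero_lt_iff.2 (pow_ne_zero 2 hvu₀)), map_mul, hv₀, mul_comm (WithZero.exp (-1 : ℤ)) (Valued.v u₀ ^ 2)]
    exact mul_le_mul_left (hD ▸ hu) _
  -- Hensel kernel: `x·x + x = −ε`, `|x| < 1`; `W := 1 + x`
  haveI := Literature.NumberTheory.Automorphic.isAdicComplete_valuedMaximalIdeal_valuedInteger_adicCompletion ↥(maximalRealSubfield L) v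
  obtain ⟨x, hx1, hxeq⟩ := Literature.NumberTheory.LocalFields.exists_valued_lt_one_mul_self_add_mul_eq
    (K := v.adicCompletion ↥(maximalRealSubfield L)) (b := 1) (c := -ε) (map_one _) (by rwa [Valuation.map_neg])
  obtain ⟨W, hW⟩ : ∃ W : v.adicCompletion ↥(maximalRealSubfield L), W = 1 + x := ⟨_, rfl⟩
  have hWv : Valued.v W = 1 := by rw [hW]; exact Valuation.map_one_add_of_lt _ hx1
  have hW0 : W ≠ 0 := (Valuation.ne_zero_iff Valued.v).1 (by rw [hWv]; exact one_ne_zero)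
  have hWW : W * W = W - ε := by rw [hW]; linear_combination hxeq
  -- the witness `z := ι 1 + ι q · τ`, `q := (u − 1) ∕ (u₀ W)`
  obtain ⟨q, hq⟩ : ∃ q : v.adicCompletion ↥(maximalRealSubfield L), q = (u - 1) / (u₀ * W) := ⟨_, rfl⟩
  have hqW : q * (u₀ * W) = u - 1 := by rw [hq]; exact div_mul_cancel₀ _ (mul_ne_zero hu₀ hW0)
  have key : q * u₀ - q ^ 2 * v₀ = u - 1 := by
    have h : (q * u₀ - q ^ 2 * v₀) * (u₀ ^ 2 * W ^ 2) = (u - 1) * (u₀ ^ 2 * W ^ 2) := by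
      linear_combination (u₀ ^ 2 * W - (q * u₀ * W + (u - 1)) * v₀) * hqW + (u - 1) * hεu - (u - 1) * u₀ ^ 2 * hWW
    exact mul_right_cancel₀ (mul_ne_zero (pow_ne_zero 2 hu₀) (pow_ne_zero 2 hW0)) h
  have hqv : Valued.v q * Valued.v u₀ = Valued.v (u - 1) := by
    rw [← hqW, map_mul, map_mul, hWv, mul_one]
  refine ⟨toPlace v w 1 + toPlace v w q * τ, ?_, ?_⟩
  · rw [toPlace_add_mul_mul_galAdicCompletionMap_eq L v w hw htr hnm 1 q]
    congr 1
    linear_combination key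
  · refine le_of_eq ?_
    have hιu : Valued.v (toPlace v w u - 1) = Valued.v (u - 1) ^ 2 := by
      rw [← map_one (toPlace v w), ← map_sub, valued_toPlace_eq_sq_of_ramified L v w hw he]
    rw [hιu, map_one, add_sub_cancel_left, map_mul, valued_toPlace_eq_sq_of_ramified L v w hw he, hτ, hD, ← hqv, mul_pow, mul_right_comm]

/-! ## §3 The head, its depth reading, and the σ-fixed dress -/

include hw he in
/-- **LEVEL NORMS AT A RAMIFIED CM PLACE** (Serre V §3 Cor. 3, `ℓ = 2`, any residue characteristic): for a uniformiser `τ` of `L_w` and `u ∈ L⁺_v` with `|u − 1|_v ≤ |στ − τ|_w`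
(«`u ∈ U_v^{(n)}`, `n ≥ d`») there is `z ∈ L_w` with `z·σ_w z = ι u` and `|z − 1|_w · |στ − τ|_w ≤ |ι u − 1|_w · exp(−1)` («`z ∈ U_w^{(2n − d + 1)} = U_w^{(ψ(n))}`»).  At a tame place
(`d = 1`) this is the `hnorm` clause of ★ `ramifiedBlock_adicCompletion`.  Proof: the Eisenstein data of `τ` (★ `exists_eisenstein_coeffs_of_ramified`) put us in the odd case §1
(`|ι u₀| < |2τ|`, including `u₀ = 0`) or the even case §2 (`|2τ| < |ι u₀|`); equality of the two values is excluded by parity (★ `sq_ne_sq_mul_exp_neg_one`).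
[cite: Serre1979, Ch. V §3 Prop. 5 (iii), Cor. 3] [cite: NeukirchANT1999, Ch. V (1.2)–(1.3)] -/
theorem exists_mul_galAdicCompletionMap_eq_of_valued_sub_one_le {τ : w.1.adicCompletion L} (hτ : Valued.v τ = WithZero.exp (-1 : ℤ))
    {u : v.adicCompletion ↥(maximalRealSubfield L)} (hu : Valued.v (u - 1) ≤ Valued.v (galAdicCompletionMap (L := L) (IsCMField.complexConj L) hw τ - τ)) :
    ∃ z : w.1.adicCompletion L, z * galAdicCompletionMap (L := L) (IsCMField.complexConj L) hw z = toPlace v w u ∧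
      Valued.v (z - 1) * Valued.v (galAdicCompletionMap (L := L) (IsCMField.complexConj L) hw τ - τ) ≤
        Valued.v (toPlace v w u - 1) * WithZero.exp (-1 : ℤ) := by
  obtain ⟨u₀, v₀, htr, hnm, -, hv₀⟩ := exists_eisenstein_coeffs_of_ramified L v w hw he hτ
  have h2ne : Valued.v (2 : v.adicCompletion ↥(maximalRealSubfield L)) ≠ 0 := (Valuation.ne_zero_iff _).2 (two_ne_zero_base L v)
  have h2τ : Valued.v (2 * τ) = Valued.v (2 : v.adicCompletion ↥(maximalRealSubfield L)) ^ 2 * WithZero.exp (-1 : ℤ) :=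
    valued_two_mul_of_uniformizer L v w hw he hτ
  rcases eq_or_ne u₀ 0 with h0 | h0
  · -- `u₀ = 0`: odd case
    have hlt : Valued.v (toPlace v w u₀) < Valued.v (2 * τ) := by
      rw [h0, map_zero, map_zero, h2τ]
      exact zero_lt_iff.2 (mul_ne_zero (pow_ne_zero 2 h2ne) WithZero.coe_ne_zero)
    exact exists_mul_galAdicCompletionMap_eq_of_valued_sub_one_le_of_lt L v w hw he hτ htr hlt hu
  · have hne : Valued.v (toPlace v w u₀) ≠ Valued.v (2 * τ) := by
      rw [valued_toPlace_eq_sq_of_ramified L v w hw he, h2τ]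
      exact sq_ne_sq_mul_exp_neg_one ((Valuation.ne_zero_iff _).2 h0) h2ne
    rcases lt_trichotomy (Valued.v (toPlace v w u₀)) (Valued.v (2 * τ)) with hlt | heq | hgt
    · exact exists_mul_galAdicCompletionMap_eq_of_valued_sub_one_le_of_lt L v w hw he hτ htr hlt hu
    · exact absurd heq hne
    · exact exists_mul_galAdicCompletionMap_eq_of_valued_sub_one_le_of_gt L v w hw he hτ htr hnm hv₀ hgt hu

include hw he in
/-- **(LN1) DEPTH READING** (Serre's letters): if `|στ − τ|_w = exp(−d)`, `d ≤ n` and `|u − 1|_v ≤ exp(−n)` then `u = z·σz ∘ ι⁻¹` with `|z − 1|_w ≤ exp(−(2n − d + 1))`, i.e.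
`U_v^{(n)} ⊆ N(U_w^{(ψ(n))})`, `ψ(n) = 2n − d + 1` (from the head: `|z − 1|·exp(−d) ≤ |u − 1|²·exp(−1) ≤ exp(−2n − 1)`). [cite: Serre1979, Ch. V §3 Cor. 3] -/
theorem exists_mul_galAdicCompletionMap_eq_of_valued_sub_one_le_exp_neg {τ : w.1.adicCompletion L} (hτ : Valued.v τ = WithZero.exp (-1 : ℤ))
    {d n : ℕ} (hd : Valued.v (galAdicCompletionMap (L := L) (IsCMField.complexConj L) hw τ - τ) = WithZero.exp (-(d : ℤ))) (hn : d ≤ n)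
    {u : v.adicCompletion ↥(maximalRealSubfield L)} (hu : Valued.v (u - 1) ≤ WithZero.exp (-(n : ℤ))) :
    ∃ z : w.1.adicCompletion L, z * galAdicCompletionMap (L := L) (IsCMField.complexConj L) hw z = toPlace v w u ∧
      Valued.v (z - 1) ≤ WithZero.exp (-(2 * (n : ℤ) - d + 1)) := by
  have hu' : Valued.v (u - 1) ≤ Valued.v (galAdicCompletionMap (L := L) (IsCMField.complexConj L) hw τ - τ) := by
    rw [hd]
    exact hu.trans (by rw [WithZero.exp_le_exp]; omega)
  obtain ⟨z, hz, hlev⟩ := exists_mul_galAdicCompletionMap_eq_of_valued_sub_one_le L v w hw he hτ hu'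
  refine ⟨z, hz, ?_⟩
  -- `|z − 1| · exp(−d) ≤ exp(−2n) · exp(−1)`
  have h1 : Valued.v (z - 1) * WithZero.exp (-(d : ℤ)) ≤ WithZero.exp (-(n : ℤ)) ^ 2 * WithZero.exp (-1 : ℤ) := by
    rw [← hd]
    refine hlev.trans ?_
    rw [← map_one (toPlace v w), ← map_sub, valued_toPlace_eq_sq_of_ramified L v w hw he]
    exact mul_le_mul_left (pow_le_pow_left₀ zero_le hu 2) _
  rcases eq_or_ne (Valued.v (z - 1)) 0 with hz0 | hz0
  · rw [hz0]; exact zero_le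
  obtain ⟨m, hm⟩ : ∃ m : ℤ, Valued.v (z - 1) = WithZero.exp m := ⟨_, (WithZero.exp_log hz0).symm⟩
  rw [hm, ← WithZero.exp_nsmul, ← WithZero.exp_add, ← WithZero.exp_add, WithZero.exp_le_exp] at h1
  rw [hm, WithZero.exp_le_exp]
  simp only [nsmul_eq_mul, Nat.cast_ofNat] at h1
  omega

include hw he in
/-- **LEVEL NORMS, σ-FIXED DRESS** (the letters of ★ `ramifiedBlock_adicCompletion`'s `hnorm` clause, wild or tame): for a uniformiser `τ` and a `σ_w`-FIXED `u ∈ L_w` with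
`|u − 1|_w ≤ |στ − τ|_w²` («depth `n ≥ d`», the square because `|ι y|_w = |y|_v²`) there is `z` with `z·σ_w z = u` and `|z − 1|_w · |στ − τ|_w ≤ |u − 1|_w · exp(−1)`.  A σ-fixed
`u` descends to `L⁺_v` (★ `exists_toPlace_eq_of_galAdicCompletionMap_eq`), and the head applies. [cite: Serre1979, Ch. V §3 Prop. 5 (iii), Cor. 3] -/
theorem exists_mul_galAdicCompletionMap_eq_of_valued_sub_one_le' {τ : w.1.adicCompletion L} (hτ : Valued.v τ = WithZero.exp (-1 : ℤ))
    (u : w.1.adicCompletion L) (hσu : galAdicCompletionMap (L := L) (IsCMField.complexConj L) hw u = u)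
    (hu : Valued.v (u - 1) ≤ Valued.v (galAdicCompletionMap (L := L) (IsCMField.complexConj L) hw τ - τ) ^ 2) :
    ∃ z : w.1.adicCompletion L, z * galAdicCompletionMap (L := L) (IsCMField.complexConj L) hw z = u ∧
      Valued.v (z - 1) * Valued.v (galAdicCompletionMap (L := L) (IsCMField.complexConj L) hw τ - τ) ≤ Valued.v (u - 1) * WithZero.exp (-1 : ℤ) := by
  obtain ⟨u', rfl⟩ := exists_toPlace_eq_of_galAdicCompletionMap_eq (IsCMField.complexConj L) w (IsCMField.complexConj_ne_one L) hw u hσu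
  have hu' : Valued.v (u' - 1) ≤ Valued.v (galAdicCompletionMap (L := L) (IsCMField.complexConj L) hw τ - τ) := by
    rw [← map_one (toPlace v w), ← map_sub, valued_toPlace_eq_sq_of_ramified L v w hw he] at hu
    exact le_of_sq_le_sq_withZero hu
  exact exists_mul_galAdicCompletionMap_eq_of_valued_sub_one_le L v w hw he hτ hu'

include hw he in
/-- **(LN3) DEPTH READING, σ-FIXED DRESS**: if `|στ − τ|_w = exp(−d)`, `d ≤ n`, and `u ∈ L_w` is `σ_w`-fixed with `|u − 1|_w ≤ exp(−2n)` (= «`u ∈ ι U_v^{(n)}`»), then `u = z·σ_w z`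
with `|z − 1|_w ≤ exp(−(2n − d + 1))` — `ι U_v^{(n)} ⊆ N(U_w^{(ψ(n))})` in the letters of ★ `ramifiedBlock_adicCompletion`. [cite: Serre1979, Ch. V §3 Cor. 3] -/
theorem exists_mul_galAdicCompletionMap_eq_of_fixed_of_valued_sub_one_le_exp_neg {τ : w.1.adicCompletion L} (hτ : Valued.v τ = WithZero.exp (-1 : ℤ))
    {d n : ℕ} (hd : Valued.v (galAdicCompletionMap (L := L) (IsCMField.complexConj L) hw τ - τ) = WithZero.exp (-(d : ℤ))) (hn : d ≤ n)
    (u : w.1.adicCompletion L) (hσu : galAdicCompletionMap (L := L) (IsCMField.complexConj L) hw u = u)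
    (hu : Valued.v (u - 1) ≤ WithZero.exp (-(2 * (n : ℤ)))) :
    ∃ z : w.1.adicCompletion L, z * galAdicCompletionMap (L := L) (IsCMField.complexConj L) hw z = u ∧
      Valued.v (z - 1) ≤ WithZero.exp (-(2 * (n : ℤ) - d + 1)) := by
  obtain ⟨u', rfl⟩ := exists_toPlace_eq_of_galAdicCompletionMap_eq (IsCMField.complexConj L) w (IsCMField.complexConj_ne_one L) hw u hσu
  have hu' : Valued.v (u' - 1) ≤ WithZero.exp (-(n : ℤ)) := by
    rw [← map_one (toPlace v w), ← map_sub, valued_toPlace_eq_sq_of_ramified L v w hw he,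
      show WithZero.exp (-(2 * (n : ℤ))) = WithZero.exp (-(n : ℤ)) ^ 2 by rw [← WithZero.exp_nsmul]; simp only [nsmul_eq_mul, Nat.cast_ofNat, mul_neg]] at hu
    exact le_of_sq_le_sq_withZero hu
  exact exists_mul_galAdicCompletionMap_eq_of_valued_sub_one_le_exp_neg L v w hw he hτ hd hn hu'

/-! ## §4 The converse inclusion: `|z·σz − 1| ≤ max (|z − 1| · D · exp 1) (|z − 1|²)` -/

include hw he in
/-- **NORMS DO NOT CLIMB FASTER THAN `ψ`**: for every `z ∈ L_w` and uniformiser `τ`, `|z·σz − 1|_w ≤ max (|z − 1|_w · |στ − τ|_w · exp 1) (|z − 1|_w²)`.  With `y := z − 1 = ι p + ι q τ`: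
`z·σz − 1 = (y + σy) + y·σy`, `y + σy = ι(2p + q u₀)` has `|·|_w = |2p + q u₀|_v² ≤ max (|2|²|p|²) (|q|²|u₀|²) ≤ |y|_w · max |ι u₀| |2τ| · exp 1`, and `|y·σy| = |y|²`.  In depth letters:
`N(U_w^{(m)}) ⊆ U_v^{(⌈(m + d − 1)∕2⌉)}` for `m ≥ d − 1` — together with the head, `N(U_w^{(2n − d + 1)}) = U_v^{(n)}` exactly for `n ≥ d`.
[cite: Serre1979, Ch. V §3 Prop. 5 (iii)] [cite: Serre1979, Ch. III §3 Prop. 7] -/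
theorem valued_mul_galAdicCompletionMap_sub_one_le {τ : w.1.adicCompletion L} (hτ : Valued.v τ = WithZero.exp (-1 : ℤ)) (z : w.1.adicCompletion L) :
    Valued.v (z * galAdicCompletionMap (L := L) (IsCMField.complexConj L) hw z - 1) ≤
      max (Valued.v (z - 1) * Valued.v (galAdicCompletionMap (L := L) (IsCMField.complexConj L) hw τ - τ) * WithZero.exp (1 : ℤ)) (Valued.v (z - 1) ^ 2) := by
  obtain ⟨u₀, v₀, htr, hnm, -, -⟩ := exists_eisenstein_coeffs_of_ramified L v w hw he hτ
  obtain ⟨p, q, hpq⟩ := exists_eq_toPlace_add_toPlace_mul L v w hw he hτ (z - 1)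
  have hσσ := galAdicCompletionMap_galAdicCompletionMap_of_smul_eq (IsCMField.complexConj L) w (IsCMField.complexConj_ne_one L) hw
  -- `z σz − 1 = (y + σ y) + y σ y` with `y = z − 1`
  have hsplit : z * galAdicCompletionMap (L := L) (IsCMField.complexConj L) hw z - 1 =
      ((z - 1) + galAdicCompletionMap (L := L) (IsCMField.complexConj L) hw (z - 1)) +
        (z - 1) * galAdicCompletionMap (L := L) (IsCMField.complexConj L) hw (z - 1) := by
    rw [map_sub, map_one]; ring
  -- the trace term: `y + σ y = ι (2p + q u₀)`
  have htrace : (z - 1) + galAdicCompletionMap (L := L) (IsCMField.complexConj L) hw (z - 1) = toPlace v w (2 * p + q * u₀) := by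
    rw [hpq, galAdicCompletionMap_toPlace_add_toPlace_mul L v w hw τ p q, map_add, map_mul, map_mul, map_ofNat, ← htr]
    ring
  have hD := valued_galAdicCompletionMap_sub_self_of_uniformizer L v w hw he hτ htr
  have hy : Valued.v (z - 1) = max (Valued.v p ^ 2) (Valued.v q ^ 2 * WithZero.exp (-1 : ℤ)) := by
    rw [hpq]; exact valued_toPlace_add_toPlace_mul L v w hw he hτ p q
  have hexp : WithZero.exp (-1 : ℤ) * WithZero.exp (1 : ℤ) = 1 := by rw [← WithZero.exp_add]; norm_num
  -- bound on the trace term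
  have htr_le : Valued.v ((z - 1) + galAdicCompletionMap (L := L) (IsCMField.complexConj L) hw (z - 1)) ≤
      Valued.v (z - 1) * Valued.v (galAdicCompletionMap (L := L) (IsCMField.complexConj L) hw τ - τ) * WithZero.exp (1 : ℤ) := by
    rw [htrace, valued_toPlace_eq_sq_of_ramified L v w hw he, hD, hy]
    refine le_trans (pow_le_pow_left₀ zero_le (Valuation.map_add _ _ _) 2) ?_
    rcases le_total (Valued.v (2 * p)) (Valued.v (q * u₀)) with hle | hle
    · rw [max_eq_right hle, map_mul, mul_pow]
      -- `|q|²|u₀|² = (|q|² exp(−1)) · |ι u₀| · exp 1`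
      calc Valued.v q ^ 2 * Valued.v u₀ ^ 2
          = Valued.v q ^ 2 * WithZero.exp (-1 : ℤ) * Valued.v (toPlace v w u₀) * WithZero.exp (1 : ℤ) := by
            rw [valued_toPlace_eq_sq_of_ramified L v w hw he,
              show Valued.v q ^ 2 * WithZero.exp (-1 : ℤ) * Valued.v u₀ ^ 2 * WithZero.exp (1 : ℤ) =
                Valued.v q ^ 2 * Valued.v u₀ ^ 2 * (WithZero.exp (-1 : ℤ) * WithZero.exp (1 : ℤ)) by ac_rfl, hexp, mul_one]
        _ ≤ _ := by
            refine mul_le_mul_left (mul_le_mul' (le_max_right _ _) (le_max_left _ _)) _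
    · rw [max_eq_left hle, map_mul, mul_pow]
      -- `|2|²|p|² = |p|² · |2τ| · exp 1`
      calc Valued.v (2 : v.adicCompletion ↥(maximalRealSubfield L)) ^ 2 * Valued.v p ^ 2
          = Valued.v p ^ 2 * Valued.v (2 * τ) * WithZero.exp (1 : ℤ) := by
            rw [valued_two_mul_of_uniformizer L v w hw he hτ,
              show Valued.v p ^ 2 * (Valued.v (2 : v.adicCompletion ↥(maximalRealSubfield L)) ^ 2 * WithZero.exp (-1 : ℤ)) * WithZero.exp (1 : ℤ) =
                Valued.v (2 : v.adicCompletion ↥(maximalRealSubfield L)) ^ 2 * Valued.v p ^ 2 * (WithZero.exp (-1 : ℤ) * WithZero.exp (1 : ℤ)) by ac_rfl,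
              hexp, mul_one]
        _ ≤ _ := by
            refine mul_le_mul_left (mul_le_mul' (le_max_left _ _) (le_max_right _ _)) _
  -- bound on the norm term
  have hnm_le : Valued.v ((z - 1) * galAdicCompletionMap (L := L) (IsCMField.complexConj L) hw (z - 1)) ≤ Valued.v (z - 1) ^ 2 := by
    rw [map_mul, valued_galAdicCompletionMap, pow_two]
  rw [hsplit]
  exact le_trans (Valuation.map_add _ _ _) (max_le_max htr_le hnm_le)

include hw he in
/-- **(LN2) DEPTH READING OF THE CONVERSE INCLUSION**: if `|στ − τ|_w = exp(−d)`, `d ≤ n` and `|z − 1|_w ≤ exp(−(2n − d + 1))` then `|z·σ_w z − 1|_w ≤ exp(−2n)` — i.e.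
`N(U_w^{(ψ(n))}) ⊆ ι U_v^{(n)}` (`z·σz` is `σ`-fixed, and `|ι x − 1|_w = |x − 1|_v²`); exponents: `(2n − d + 1) + d − 1 = 2n` for the trace term, `2(2n − d + 1) ≥ 2n` iff `n ≥ d − 1` for
the norm term. [cite: Serre1979, Ch. V §3 Prop. 5 (iii)] -/
theorem valued_mul_galAdicCompletionMap_sub_one_le_exp_neg {τ : w.1.adicCompletion L} (hτ : Valued.v τ = WithZero.exp (-1 : ℤ))
    {d n : ℕ} (hd : Valued.v (galAdicCompletionMap (L := L) (IsCMField.complexConj L) hw τ - τ) = WithZero.exp (-(d : ℤ))) (hn : d ≤ n)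
    {z : w.1.adicCompletion L} (hz : Valued.v (z - 1) ≤ WithZero.exp (-(2 * (n : ℤ) - d + 1))) :
    Valued.v (z * galAdicCompletionMap (L := L) (IsCMField.complexConj L) hw z - 1) ≤ WithZero.exp (-(2 * (n : ℤ))) := by
  refine (valued_mul_galAdicCompletionMap_sub_one_le L v w hw he hτ z).trans (max_le ?_ ?_)
  · rw [hd]
    rcases eq_or_ne (Valued.v (z - 1)) 0 with h0 | h0
    · rw [h0, zero_mul, zero_mul]; exact zero_le
    obtain ⟨m, hm⟩ : ∃ m : ℤ, Valued.v (z - 1) = WithZero.exp m := ⟨_, (WithZero.exp_log h0).symm⟩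
    rw [hm, WithZero.exp_le_exp] at hz
    rw [hm, ← WithZero.exp_add, ← WithZero.exp_add, WithZero.exp_le_exp]
    omega
  · rcases eq_or_ne (Valued.v (z - 1)) 0 with h0 | h0
    · rw [h0, zero_pow two_ne_zero]; exact zero_le
    obtain ⟨m, hm⟩ : ∃ m : ℤ, Valued.v (z - 1) = WithZero.exp m := ⟨_, (WithZero.exp_log h0).symm⟩
    rw [hm, WithZero.exp_le_exp] at hz
    rw [hm, ← WithZero.exp_nsmul, WithZero.exp_le_exp]
    simp only [nsmul_eq_mul, Nat.cast_ofNat]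
    omega

end Literature.NumberTheory.Automorphic.UnitaryGroup

end
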